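import Summits.CriticalPhenomena.PercolationContinuityZ3.Theorems.Transplant.SharpnessGridWalks
import HarnessLib

/-!
# The logarithmic wedge is connected at infinity (one end)

House module of the `TransplantSharpness` programme (sharpness desk, row 5 of the table: Grimmett's logarithmic wedge
`W = logWedge a b`, the original non-quasi-transitive graph percolating at its critical point).  The last hypothesis
column of row 5 in the kernel: `W` has ONE END in the combinatorial form — for every finite set `K` of vertices, all
vertices of `W` far enough to the right lie outside `K` and are joined to each other inside `ℤ²[W ∖ K]`
(`logWedge_connected_at_infinity`; route: row to the right, then column — both stay to the right of `K`, and rows of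
the wedge extend rightwards, columns of the wedge are intervals, `SharpnessGridWalks`).  Companion of
`gridWedge_connected_at_infinity` (`SharpnessGridOneEnd`, the gridded wedge of row 83).
-/

namespace Summit.CriticalPhenomena.PercolationContinuityZ3.Theorems.TransplantSharpness

open Literature.Probability.LatticeModels
open Literature.Barriers.CriticalPhenomena (logWedge)

variable {a b : ℝ}

/-- **Two wedge points to the right of abscissa `R` are joined inside `ℤ²[S]` for any `S` containing every wedge point
to the right of `R`** (row to the right, then column). [folklore] -/
theorem exists_walk_of_mem_logWedge_right (ha : 0 ≤ a) (hb : 0 ≤ b) {S : Set (Site 2)} {R : ℤ}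
    (hS : ∀ z : Site 2, z ∈ logWedge a b → R < z 0 → z ∈ S)
    {i j i' j' : ℤ} (hx : (![i, j] : Site 2) ∈ logWedge a b) (hy : (![i', j'] : Site 2) ∈ logWedge a b)
    (hi : R < i) (hi' : R < i') :
    ∃ (hxS : (![i, j] : Site 2) ∈ S) (hyS : (![i', j'] : Site 2) ∈ S),
      ((zdGraph 2).induce S).Reachable ⟨![i, j], hxS⟩ ⟨![i', j'], hyS⟩ := by
  -- the construction for `i ≤ i'`, packaged so that it can be used in both orders
  have key : ∀ {i j i' j' : ℤ}, (![i, j] : Site 2) ∈ logWedge a b → (![i', j'] : Site 2) ∈ logWedge a b →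
      R < i → i ≤ i' → ∃ (hxS : (![i, j] : Site 2) ∈ S) (hyS : (![i', j'] : Site 2) ∈ S),
        ((zdGraph 2).induce S).Reachable ⟨![i, j], hxS⟩ ⟨![i', j'], hyS⟩ := by
    intro i j i' j' hx hy hi hii
    have hmid : (![i', j] : Site 2) ∈ logWedge a b := row_right_mem_logWedge ha hb hx hii
    have hxS : (![i, j] : Site 2) ∈ S := hS _ hx (by simpa using hi)
    have hmidS : (![i', j] : Site 2) ∈ S := hS _ hmid (by simp; omega)
    have hyS : (![i', j'] : Site 2) ∈ S := hS _ hy (by simp; omega)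
    obtain ⟨w₁, -⟩ := exists_walk_row (S := S) (i := i) (i' := i') (j := j)
      (fun t ht1 _ => hS _ (row_right_mem_logWedge ha hb hx (by rw [min_eq_left hii] at ht1; exact ht1))
        (by rw [min_eq_left hii] at ht1; simp; omega)) hxS hmidS
    obtain ⟨w₂, -⟩ := exists_walk_col (S := S) (i := i') (j := j) (j' := j')
      (fun t ht1 ht2 => hS _ (col_segment_mem_logWedge hmid hy ht1 ht2) (by simp; omega)) hmidS hyS
    exact ⟨hxS, hyS, ⟨w₁.append w₂⟩⟩
  rcases le_total i i' with hii | hii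
  · exact key hx hy hi hii
  · obtain ⟨hyS, hxS, h⟩ := key hy hx hi' hii
    exact ⟨hxS, hyS, h.symm⟩

/-- **The logarithmic wedge is connected at infinity (one end)**: for `a, b ≥ 0` and every finite `K ⊆ ℤ²` there is `R`
such that all wedge points with abscissa `> R` lie outside `K` and are pairwise joined inside `ℤ²[W ∖ K]`.  Hence
`W ∖ K` has exactly one infinite component for every finite `K`: `W` has one end. [folklore] -/
theorem logWedge_connected_at_infinity (ha : 0 ≤ a) (hb : 0 ≤ b) (K : Finset (Site 2)) :
    ∃ R : ℤ, ∀ x y : Site 2, x ∈ logWedge a b → y ∈ logWedge a b → R < x 0 → R < y 0 →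
      ∃ (hx : x ∈ logWedge a b \ (K : Set (Site 2))) (hy : y ∈ logWedge a b \ (K : Set (Site 2))),
        ((zdGraph 2).induce (logWedge a b \ (K : Set (Site 2)))).Reachable ⟨x, hx⟩ ⟨y, hy⟩ := by
  classical
  -- `R` bounds the abscissae of `K`
  refine ⟨((K.sup fun z => (z 0).toNat : ℕ) : ℤ), fun x y hxW hyW hxR hyR => ?_⟩
  have hS : ∀ z : Site 2, z ∈ logWedge a b → ((K.sup fun z => (z 0).toNat : ℕ) : ℤ) < z 0 →
      z ∈ logWedge a b \ (K : Set (Site 2)) := by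
    intro z hz hzR
    refine ⟨hz, fun hzK => ?_⟩
    have h1 : (z 0).toNat ≤ K.sup fun z => (z 0).toNat := Finset.le_sup (f := fun z : Site 2 => (z 0).toNat) hzK
    have h2 : z 0 ≤ ((z 0).toNat : ℤ) := Int.self_le_toNat (z 0)
    omega
  have ex : x = ![x 0, x 1] := by ext k; fin_cases k <;> rfl
  have ey : y = ![y 0, y 1] := by ext k; fin_cases k <;> rfl
  rw [ex] at hxW hxR
  rw [ey] at hyW hyR
  obtain ⟨hxS, hyS, h⟩ := exists_walk_of_mem_logWedge_right ha hb hS hxW hyW (by simpa using hxR) (by simpa using hyR)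
  have e1 : ∀ (h1 : x ∈ logWedge a b \ (K : Set (Site 2))),
      (⟨x, h1⟩ : ↥(logWedge a b \ (K : Set (Site 2)))) = ⟨![x 0, x 1], hxS⟩ := fun _ => Subtype.ext ex
  have e2 : ∀ (h2 : y ∈ logWedge a b \ (K : Set (Site 2))),
      (⟨y, h2⟩ : ↥(logWedge a b \ (K : Set (Site 2)))) = ⟨![y 0, y 1], hyS⟩ := fun _ => Subtype.ext ey
  refine ⟨ex ▸ hxS, ey ▸ hyS, ?_⟩
  rw [e1, e2]
  exact h

end Summit.CriticalPhenomena.PercolationContinuityZ3.Theorems.TransplantSharpness
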